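import Summits.QuantumFields.BalabanUV.Beta.FP.TowerDoorGaugeThetaG
import Summits.QuantumFields.BalabanUV.Beta.FP.TowerDoorGaugeFunctional

/-!
# `BalabanUV.Beta.FP.TowerDoorGaugeFunctionalG` — row D1 ∕ (C1) OWNER «beta-an2», PART 86, ROUTE T (β1), v11 (R-root): **PART 61 `TowerDoorGaugeFunctional` OVER `Q`** — LEMMA U ⇒ `hΘ`
# for every covariant `ℓ¹` door functional, for the lattice gauge function `lamZG Lc Q …`: §1 kernel-generic shapes, §2 the record's chart under the displayed two-block letter (TB) `hQ`,
# §3 the `ℓ^∞` packaging in the END's types (`memℓp_top_lamZG ∕ _record`, `tsum_l1Pairing_lamZG_record_eq_zero` — the END's `hΘ` AS TYPED); PART 61 line for line with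
# `lamZ ↦ lamZG Lc Q` (`summable_mul_of_memℓp_top ∕ l1Pairing ∕ l1Pairing_apply` are row-free and REUSED by name)
# (β-function cell `pub-balaban`, BINDER-OWNERS row D1; FINDING AN2-82-1, road A-4 l.69064)

WHAT ([folklore] BY NAME; no `def`, no `def … : Prop`, nothing cited, 0 sorry): §1 `lamZG_eq_lamZG_zero_sub`, `tsum_mul_translate_lamZG`, `tsum_tsum_translate_mul_lamZG_eq_zero`;
§2 `tsum_tsum_translate_mul_lamZG_record_eq_zero` (under `hQ`); §3 `memℓp_top_lamZG`, `memℓp_top_lamZG_record`, `tsum_l1Pairing_lamZG_record_eq_zero` (under `hQ`).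
WHAT THIS IS NOT: nothing of v10 ∕ the END of record moves; nothing of Bałaban's asserted, valued or discharged; 0 estimates beyond [folklore] bookkeeping; 0∕4 row-D1 binders
(hW, hR, D1Tel, D1Rep); ROOT M‴ p325680 ∕ P5c ∕ D6 untouched; NOT (C1), NOT (T-ID), NOT D1, NEVER «G-an2-4 closed», NOT BetaPertH, NOT continuum, NOT Clay.

NOT (T-ID), NOT D1, NEVER «G-an2-4 closed», NOT BetaPertH, NOT continuum, NOT Clay.

HONEST DEPENDENCY (page 1, mandatory): continuum YM on T⁴ ⇐ BetaPertH ∧ nine spine estimates (0/9 proved); BetaPertH ⇐ (D1) ∧ (D4) ∧ CAP+tail;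
G-an2-4 gates asym, D1 and NE2/3/4.  HONEST FRAMING (cell contract, verbatim): «discharging `BetaPertH` makes Bałaban's UV stability UNCONDITIONAL —
a real constructive-QFT result; it is NOT the continuum limit and NOT the Clay problem.»  ABSOLUTE RULE (cell charter, verbatim): «No internally-minted
statement may enter as a cited fact. Every hypothesis is either kernel-proved in this package or a verbatim quotation of a PUBLISHED theorem with page
reference. The manuscript(s) under audit are NOT citable for their own disputed steps — they are the thing under adjudication; programme-internal
(2001/route/tribunal) claims are never citable.»  Row D1 ∕ (C1) OWNER «beta-an2», b2b-balaban-beta-an2 gen 82, 2026-08-29.  No existing file touched.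
-/

noncomputable section

open Finset
open scoped BigOperators ENNReal
open Literature.MathematicalPhysics.QuantumFieldTheory
open Literature.MathematicalPhysics.QuantumFieldTheory.Balaban1983to89
open Literature.MathematicalPhysics.QuantumFieldTheory.Balaban1983to89.Beta
open B6Lemma24Torus (pbox)
open AffineAveraging (Site toSite unitVec)
open OneStepResolventKernel (Fib)
open ExpKernelCalculus (MKer Decays)
open HessKerRate (scaleK)
open Summit.QuantumFields.BalabanUV.Beta.CompositeOneShotJetData (Roots AN)
open Summit.QuantumFields.BalabanUV.Beta.FP.TorusCompositeObjects (bigRatio bigRatio_pos)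
open B5Prop11Plancherel (fine)
open Literature.MathematicalPhysics.QuantumFieldTheory.LatticeForm (quo)
open Summit.QuantumFields.BalabanUV.Beta.FP.TorusCompositeObjectsG (StepRows)
open Summit.QuantumFields.BalabanUV.Beta.FP.TowerDoorGaugeRefDefsG (lamZG)
open Summit.QuantumFields.BalabanUV.Beta.FP.TowerDoorGaugeLatticeSumG (lamZG_translate tsum_lamZG_sources_record)
open Summit.QuantumFields.BalabanUV.Beta.FP.TowerDoorGaugeBound (decays_scaleK_AN)
open Summit.QuantumFields.BalabanUV.Beta.FP.TowerDoorGaugeBoundG (exists_abs_lamZG_le)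
open Summit.QuantumFields.BalabanUV.Beta.FP.TowerDoorGaugeThetaG (tsum_tsum_mul_lamZG_eq_zero)
open Summit.QuantumFields.BalabanUV.Beta.FP.TowerDoorGaugeFunctional (summable_mul_of_memℓp_top l1Pairing l1Pairing_apply)

namespace Summit.QuantumFields.BalabanUV.Beta.FP.TowerDoorGaugeFunctionalG

variable {d : ℕ}

/-! ## §1 Over `Q`, kernel-generic: `hτ`'s and `hΘ`'s shapes for a covariant `ℓ¹` functional -/

section Generic

variable (Lc : ℕ) [NeZero Lc] (Q : StepRows d Lc) (lev : ℕ → ℕ) (rs : ℕ → (Fin (d + 1) → ℕ))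
  (hrs : ∀ k i, 0 ≤ toSite (rs k) i ∧ toSite (rs k) i < (Lc : ℤ)) (n : ℕ) (A : MKer (d + 1) (Fib d))

/-- [folklore] `λℤ_(μ,z)(u) = λℤ_(μ,0)(u − L•z)` (PART 58 `lamZG_translate`). -/
theorem lamZG_eq_lamZG_zero_sub (μ : Fin (d + 1)) (z u : Site (d + 1)) :
    lamZG Lc Q lev rs hrs n A μ z u = lamZG Lc Q lev rs hrs n A μ 0 (u - ((bigRatio Lc (n + 1) : ℕ) : ℤ) • z) := by
  have h := lamZG_translate Lc Q lev rs hrs n A μ 0 (u - ((bigRatio Lc (n + 1) : ℕ) : ℤ) • z) z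
  rw [zero_add, sub_add_cancel] at h
  exact h

/-- [folklore] **`tsum_mul_translate_lamZG` — `hτ`'s SHAPE**: `Σ'_u ω(u − L•y)·λℤ_(μ,z)(u) = Σ'_u ω(u − L•(y − z))·λℤ_(μ,0)(u)` (re-index `u ↦ u + L•z`; no convergence needed). -/
theorem tsum_mul_translate_lamZG (ω : Site (d + 1) → ℝ) (μ : Fin (d + 1)) (y z : Site (d + 1)) :
    (∑' u : Site (d + 1), ω (u - ((bigRatio Lc (n + 1) : ℕ) : ℤ) • y) * lamZG Lc Q lev rs hrs n A μ z u)
      = ∑' u : Site (d + 1), ω (u - ((bigRatio Lc (n + 1) : ℕ) : ℤ) • (y - z)) * lamZG Lc Q lev rs hrs n A μ 0 u := by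
  rw [← (Equiv.addRight (((bigRatio Lc (n + 1) : ℕ) : ℤ) • z)).tsum_eq
    (fun u : Site (d + 1) => ω (u - ((bigRatio Lc (n + 1) : ℕ) : ℤ) • y) * lamZG Lc Q lev rs hrs n A μ z u)]
  refine tsum_congr fun u => ?_
  simp only [Equiv.coe_addRight]
  rw [lamZG_eq_lamZG_zero_sub Lc Q lev rs hrs n A μ z, add_sub_cancel_right, smul_sub]
  congr 2
  abel

/-- [folklore] **`tsum_tsum_translate_mul_lamZG_eq_zero` — `hΘ`'s SHAPE**: for a `δ`-decaying chart (`0 < δ`), `Σ|ω| < ∞` and vanishing sitewise source sums (PART 58),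
`Σ'_y Σ'_u ω(u − L•y)·λℤ_(μ,0)(u) = 0` (re-index `u ↦ u + L•y`, covariance `λℤ_(μ,0)(u + L•y) = λℤ_(μ,−y)(u)`, `y ↦ −y`, PART 60 `tsum_tsum_mul_lamZG_eq_zero`). -/
theorem tsum_tsum_translate_mul_lamZG_eq_zero {C δ : ℝ} (hA : Decays A C δ) (hδ : 0 < δ)
    (ω : Site (d + 1) → ℝ) (hω : Summable (fun u => |ω u|)) (μ : Fin (d + 1))
    (hzero : ∀ u : Site (d + 1), (∑' z : Site (d + 1), lamZG Lc Q lev rs hrs n A μ z u) = 0) :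
    (∑' y : Site (d + 1), ∑' u : Site (d + 1), ω (u - ((bigRatio Lc (n + 1) : ℕ) : ℤ) • y) * lamZG Lc Q lev rs hrs n A μ 0 u) = 0 := by
  have e : ∀ y : Site (d + 1), (∑' u : Site (d + 1), ω (u - ((bigRatio Lc (n + 1) : ℕ) : ℤ) • y) * lamZG Lc Q lev rs hrs n A μ 0 u)
      = ∑' u : Site (d + 1), ω u * lamZG Lc Q lev rs hrs n A μ (-y) u := by
    intro y
    rw [← (Equiv.addRight (((bigRatio Lc (n + 1) : ℕ) : ℤ) • y)).tsum_eq
      (fun u : Site (d + 1) => ω (u - ((bigRatio Lc (n + 1) : ℕ) : ℤ) • y) * lamZG Lc Q lev rs hrs n A μ 0 u)]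
    refine tsum_congr fun u => ?_
    simp only [Equiv.coe_addRight, add_sub_cancel_right]
    have h := lamZG_translate Lc Q lev rs hrs n A μ (-y) u y
    rw [neg_add_cancel] at h
    rw [h]
  simp_rw [e]
  rw [← (Equiv.neg (Site (d + 1))).tsum_eq (fun y : Site (d + 1) => ∑' u : Site (d + 1), ω u * lamZG Lc Q lev rs hrs n A μ (-y) u)]
  simp only [Equiv.neg_apply, neg_neg]
  exact tsum_tsum_mul_lamZG_eq_zero Lc Q lev rs hrs n hA hδ ω hω μ hzero

end Generic

/-! ## §2 The record's chart, over `Q` -/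

section Record

variable {Lc : ℕ} [NeZero Lc] (Q : StepRows 3 Lc)
  (hQ : ∀ (M : Fin (3 + 1) → ℕ) [∀ μ, NeZero (M μ)] (ℓ : ℕ) (r : Fin (3 + 1) → ℕ) (a : ↥(pbox M)) (ν : Fin (3 + 1))
      (b : ↥(pbox (fine Lc M))) (κ : Fin (3 + 1)),
      (a : Site (3 + 1)) + unitVec ν ∈ pbox M → Q M ℓ r (a, ν) (b, κ) ≠ 0 →
        (quo Lc (b : Site (3 + 1)) = a ∨ quo Lc (b : Site (3 + 1)) = (a : Site (3 + 1)) + unitVec ν) ∧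
        (quo Lc ((b : Site (3 + 1)) + unitVec κ) = a ∨ quo Lc ((b : Site (3 + 1)) + unitVec κ) = (a : Site (3 + 1)) + unitVec ν))
  (R : Roots Lc) (lev : ℕ → ℕ) (rs : ℕ → (Fin (3 + 1) → ℕ))
  (hrs : ∀ k i, 0 ≤ toSite (rs k) i ∧ toSite (rs k) i < (Lc : ℤ)) (n : ℕ) (σ : Fib 3 → ℝ)
include hQ

/-- [folklore] **`tsum_tsum_translate_mul_lamZG_record_eq_zero`** — `hΘ`'s shape for the record's chart, hypothesis-free but for `Σ|ω| < ∞`: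
`Σ'_y Σ'_u ω(u − L•y)·lamZG Lc Q lev rs hrs n (scaleK σ σ (AN R (n+1))) μ 0 u = 0`. -/
theorem tsum_tsum_translate_mul_lamZG_record_eq_zero (ω : Site (3 + 1) → ℝ) (hω : Summable (fun u => |ω u|)) (μ : Fin (3 + 1)) :
    (∑' y : Site (3 + 1), ∑' u : Site (3 + 1),
        ω (u - ((bigRatio Lc (n + 1) : ℕ) : ℤ) • y) * lamZG Lc Q lev rs hrs n (scaleK σ σ (AN R (n + 1))) μ 0 u) = 0 := by
  obtain ⟨δ, C, hδ, _, hA⟩ := decays_scaleK_AN R σ (n + 1)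
  exact tsum_tsum_translate_mul_lamZG_eq_zero Lc Q lev rs hrs n (scaleK σ σ (AN R (n + 1))) hA hδ ω hω μ
    (fun u => tsum_lamZG_sources_record Q hQ R lev rs hrs n σ μ u)

end Record

/-! ## §3 The `ℓ^∞` packaging in the END's types (`V j := ↥(lp (fun _ : Site 4 => ℝ) ⊤)`), over `Q` -/

section Linfty

variable (Lc : ℕ) [NeZero Lc] (Q : StepRows d Lc) (lev : ℕ → ℕ) (rs : ℕ → (Fin (d + 1) → ℕ))
  (hrs : ∀ k i, 0 ≤ toSite (rs k) i ∧ toSite (rs k) i < (Lc : ℤ)) (n : ℕ)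

/-- [folklore] **`λℤ_(μ,z)` IS A BOUNDED GAUGE FUNCTION**, over `Q` (`Memℓp … ⊤`, PART 83 `exists_abs_lamZG_le`). -/
theorem memℓp_top_lamZG {A : MKer (d + 1) (Fib d)} {C δ : ℝ} (hA : Decays A C δ) (hδ : 0 ≤ δ) (μ : Fin (d + 1)) (z : Site (d + 1)) :
    Memℓp (fun u : Site (d + 1) => lamZG Lc Q lev rs hrs n A μ z u) ⊤ := by
  obtain ⟨K, _, h⟩ := exists_abs_lamZG_le Lc Q lev rs hrs n hA hδ
  exact memℓp_infty ⟨K, by rintro _ ⟨u, rfl⟩; simpa [Real.norm_eq_abs] using h μ z u⟩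

variable {Lc' : ℕ} [NeZero Lc'] (Q' : StepRows 3 Lc')
  (hQ' : ∀ (M : Fin (3 + 1) → ℕ) [∀ μ, NeZero (M μ)] (ℓ : ℕ) (r : Fin (3 + 1) → ℕ) (a : ↥(pbox M)) (ν : Fin (3 + 1))
      (b : ↥(pbox (fine Lc' M))) (κ : Fin (3 + 1)),
      (a : Site (3 + 1)) + unitVec ν ∈ pbox M → Q' M ℓ r (a, ν) (b, κ) ≠ 0 →
        (quo Lc' (b : Site (3 + 1)) = a ∨ quo Lc' (b : Site (3 + 1)) = (a : Site (3 + 1)) + unitVec ν) ∧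
        (quo Lc' ((b : Site (3 + 1)) + unitVec κ) = a ∨ quo Lc' ((b : Site (3 + 1)) + unitVec κ) = (a : Site (3 + 1)) + unitVec ν))
  (R : Roots Lc') (rs' : ℕ → (Fin (3 + 1) → ℕ))
  (hrs' : ∀ k i, 0 ≤ toSite (rs' k) i ∧ toSite (rs' k) i < (Lc' : ℤ)) (σ : Fib 3 → ℝ)

/-- [folklore] the record's `λℤ_(μ,z)` over `Q′` is a bounded gauge function. -/
theorem memℓp_top_lamZG_record (μ : Fin (3 + 1)) (z : Site (3 + 1)) :
    Memℓp (fun u : Site (3 + 1) => lamZG Lc' Q' lev rs' hrs' n (scaleK σ σ (AN R (n + 1))) μ z u) ⊤ := by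
  obtain ⟨δ, C, hδ, _, hA⟩ := decays_scaleK_AN R σ (n + 1)
  exact memℓp_top_lamZG Lc' Q' lev rs' hrs' n hA hδ.le μ z

include hQ' in
/-- [folklore] **`tsum_l1Pairing_lamZG_record_eq_zero` — THE END's `hΘ` AS TYPED, over `Q′` (under the two-block letter `hQ′`)**: with `V := ↥(lp (fun _ : Site 4 => ℝ) ⊤)`,
`τ κ y := κτ • l1Pairing (ω_κ(· − L•y))`, `lam μ z := ⟨λℤ_(μ,z), memℓp⟩`: `Σ'_y τ κ y (lam μ 0) = 0`. -/
theorem tsum_l1Pairing_lamZG_record_eq_zero (ω : Site (3 + 1) → ℝ) (hω : Summable (fun u => |ω u|)) (κτ : ℝ) (μ : Fin (3 + 1)) :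
    (∑' y : Site (3 + 1), (κτ • l1Pairing (fun u : Site (3 + 1) => ω (u - ((bigRatio Lc' (n + 1) : ℕ) : ℤ) • y))
        ((Equiv.subRight (((bigRatio Lc' (n + 1) : ℕ) : ℤ) • y)).summable_iff.mpr hω))
      (⟨fun u : Site (3 + 1) => lamZG Lc' Q' lev rs' hrs' n (scaleK σ σ (AN R (n + 1))) μ 0 u, memℓp_top_lamZG_record lev n Q' R rs' hrs' σ μ 0⟩ :
        ↥(lp (fun _ : Site (3 + 1) => ℝ) ⊤))) = 0 := by
  simp only [LinearMap.smul_apply, l1Pairing_apply, smul_eq_mul]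
  rw [tsum_mul_left, tsum_tsum_translate_mul_lamZG_record_eq_zero Q' hQ' R lev rs' hrs' n σ ω hω μ, mul_zero]

end Linfty

end Summit.QuantumFields.BalabanUV.Beta.FP.TowerDoorGaugeFunctionalG

end
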